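import Summits.Ventures.DiscreteObjects.Hadamard.ParityCyclotomic29
import Summits.Ventures.DiscreteObjects.Hadamard.ParityPermModule29
import Summits.Ventures.DiscreteObjects.Hadamard.ParityLift167
import Summits.Ventures.DiscreteObjects.Hadamard.PrimeOrder29

/-!
# Hadamard 668 census, family F12 — order 29 excluded IN THE KERNEL (Lander's parity theorem for the 2-(667,333,166) design)

Framing: lottery ticket; floor = certified bounds/negative ranges.

Cell pub-namedobj (venture DiscreteObjects), target (H), hadamard gen 8.  `PrimeOrder29` left exactly one paper step in census
line (4): an automorphism of order `29` of the 2-(667,333,166) design is fixed-point-free with `23 + 23` orbits (kernel), and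
Lander's parity theorem (Symmetric Designs: An Algebraic Approach, 1983, Thm 3.20(2); `167⁷ ≡ -1 (mod 29)`) says the number of
orbits of length `29` must be EVEN.  This file proves that parity statement for our parameters inside the kernel
(`two_dvd_card_blockClasses_29`) and concludes **`no_automorphism_29`**: a `0/1` incidence function `N : P → B → ℤ` with
`|P| = |B| = 667`, row/column sums `333`, row/column inner products `166`, admits no automorphism pair `(ρ, τ)` with
`ρ^29 = τ^29 = 1`, `ρ ≠ 1`.

Proof (linear algebra over `F = ZMod 167`, no cyclotomic integers): let `h` be an irreducible factor of `Φ₂₉` over `F`,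
`h h' = X²⁹ - 1`, `T_V = (u ↦ u ∘ ρ)`, `T_W = (w ↦ w ∘ τ)`, `M_V = ker h(T_V)`, `M_W = ker h(T_W)` (complements `M'_V, M'_W`
the kernels of `h'`).  The reduced incidence matrix `N̄` and its transpose intertwine `T_W, T_V`, so `N̄ M_W ⊆ M_V`,
`N̄ᵀ M_V ⊆ M_W`; `N̄ N̄ᵀ = N̄ᵀ N̄ = -J` vanish on `M_V, M_W` (coordinate sums vanish there since `h(1) ≠ 0`); the LIFTING LEMMA
(`ParityLift167`) gives `ker N̄ ∩ M_W = U := N̄ᵀ(M_V)`; self-reciprocity of `h` (`ParityCyclotomic29`, Frobenius⁷) makes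
`M ⊥ M'` for the dot product, whence `U^⊥ = U ⊕ M'_W` and `dim M_W = 2 · dim U`; `U` is `T_W`-invariant and killed by `h(T_W)`,
so `deg h ∣ dim U`; and `dim M_W = 23 · deg h` (`ParityPermModule29`, 23 free orbits).  Hence `23` is even — contradiction.
Ours, not literature; no `sorry`; reference for the classical theorem: [cite: book:lander1983-symmetric-designs-algebraic-approach,
Thm 3.20(2) p.95].
-/

open Polynomial Finset BigOperators Matrix

namespace Summit.Ventures.DiscreteObjects.Hadamard

variable {P B : Type*} [Fintype P] [DecidableEq P] [Fintype B] [DecidableEq B]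

/-- **Lander's parity theorem for `p = 29`, `n = 167` (kernel).**  For the 2-(667,333,166) incidence function with an
automorphism pair of order dividing `29` acting fixed-point-freely on blocks (`|B| = 29 · #classes`), the number of block
classes is even. -/
theorem two_dvd_card_blockClasses_29 (N : P → B → ℤ) (h01 : ∀ x y, N x y = 0 ∨ N x y = 1)
    (hrow : ∀ x, ∑ y, N x y = 333) (hpair : ∀ x x', x ≠ x' → ∑ y, N x y * N x' y = 166)
    (hcol : ∀ y, ∑ x, N x y = 333) (hcpair : ∀ y y', y ≠ y' → ∑ x, N x y * N x y' = 166)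
    (ρ : Equiv.Perm P) (τ : Equiv.Perm B) (hN : ∀ x y, N (ρ x) (τ y) = N x y)
    (hρ : ρ ^ 29 = 1) (hτ : τ ^ 29 = 1) (hcardB : Fintype.card B = (blockClasses τ 29).card * 29) :
    2 ∣ (blockClasses τ 29).card := by
  haveI : Fact (Nat.Prime 167) := ⟨by norm_num⟩
  have hp29 : Nat.Prime 29 := by norm_num
  -- (1) the polynomials h, h'
  set Φ : (ZMod 167)[X] := cyclotomic 29 (ZMod 167) with hΦ
  have hΦdeg : Φ.natDegree ≠ 0 := by rw [hΦ, natDegree_cyclotomic29]; norm_num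
  set h : (ZMod 167)[X] := Φ.factor with hh
  have hirr : Irreducible h := irreducible_factor Φ
  have hdvd : h ∣ Φ := factor_dvd_of_natDegree_ne_zero hΦdeg
  obtain ⟨h', hh'⟩ : h ∣ X ^ 29 - 1 := dvd_trans hdvd cyclotomic29_dvd_X_pow_sub_one
  have hmul : h * h' = X ^ 29 - 1 := hh'.symm
  have hcop : IsCoprime h h' := isCoprime_of_mul_eq_X_pow_29_sub_one hmul
  have h1 : h.eval 1 ≠ 0 := eval_one_ne_zero_of_dvd_cyclotomic29 hdvd
  have h1' : h'.eval 1 = 0 := eval_one_eq_zero_of_mul_eq hmul h1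
  have hrec : h ∣ h.comp (X ^ 28) := dvd_comp_X_pow_28_of_dvd_cyclotomic29 hirr hdvd
  have hdpos : 0 < h.natDegree := Irreducible.natDegree_pos hirr
  -- (2) operators and kernels
  set TV := LinearMap.funLeft (ZMod 167) (ZMod 167) (⇑ρ) with hTV
  set TW := LinearMap.funLeft (ZMod 167) (ZMod 167) (⇑τ) with hTW
  have hTV_apply : ∀ u x, TV u x = u (ρ x) := fun _ _ => rfl
  have hTW_apply : ∀ w y, TW w y = w (τ y) := fun _ _ => rfl
  set MV := LinearMap.ker (aeval TV h) with hMV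
  set MV' := LinearMap.ker (aeval TV h') with hMV'
  set MW := LinearMap.ker (aeval TW h) with hMW
  set MW' := LinearMap.ker (aeval TW h') with hMW'
  have hcV : IsCompl MV MV' := isCompl_ker_aeval_funLeft ρ hρ hmul hcop
  have hcW : IsCompl MW MW' := isCompl_ker_aeval_funLeft τ hτ hmul hcop
  -- (3) the matrix mod 167 and its two linear maps
  set Nb : Matrix P B (ZMod 167) := Matrix.of fun x y => (N x y : ZMod 167) with hNb
  set LN : (B → ZMod 167) →ₗ[ZMod 167] (P → ZMod 167) := Matrix.mulVecLin Nb with hLN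
  set LT : (P → ZMod 167) →ₗ[ZMod 167] (B → ZMod 167) := Matrix.mulVecLin Nbᵀ with hLT
  have hLN_apply : ∀ w x, LN w x = ∑ y, (N x y : ZMod 167) * w y := fun _ _ => rfl
  have hLT_apply : ∀ u y, LT u y = ∑ x, (N x y : ZMod 167) * u x := fun _ _ => rfl
  have hadj : ∀ u w, LT u ⬝ᵥ w = u ⬝ᵥ LN w := by
    intro u w
    rw [hLT, hLN, Matrix.mulVecLin_apply, Matrix.mulVecLin_apply, Matrix.mulVec_transpose, ← dotProduct_mulVec]
  have hadj' : ∀ w u, LN w ⬝ᵥ u = w ⬝ᵥ LT u := by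
    intro w u
    rw [dotProduct_comm, ← hadj, dotProduct_comm]
  -- (4) intertwining
  have hLN_T : LN ∘ₗ TW = TV ∘ₗ LN := by
    refine LinearMap.ext fun w => funext fun x => ?_
    rw [LinearMap.comp_apply, LinearMap.comp_apply, hTV_apply, hLN_apply, hLN_apply]
    simp only [hTW_apply]
    rw [← Equiv.sum_comp τ (fun y => (N (ρ x) y : ZMod 167) * w y)]
    simp only [hN]
  have hLT_T : LT ∘ₗ TV = TW ∘ₗ LT := by
    refine LinearMap.ext fun u => funext fun y => ?_
    rw [LinearMap.comp_apply, LinearMap.comp_apply, hTW_apply, hLT_apply, hLT_apply]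
    simp only [hTV_apply]
    rw [← Equiv.sum_comp ρ (fun x => (N x (τ y) : ZMod 167) * u x)]
    simp only [hN]
  have hLN_mem : ∀ (g : (ZMod 167)[X]) (w : B → ZMod 167), w ∈ LinearMap.ker (aeval TW g) →
      LN w ∈ LinearMap.ker (aeval TV g) := by
    intro g w hw
    rw [LinearMap.mem_ker] at hw ⊢
    rw [← aeval_apply_of_comp_eq TW TV LN hLN_T g w, hw, map_zero]
  have hLT_mem : ∀ (g : (ZMod 167)[X]) (u : P → ZMod 167), u ∈ LinearMap.ker (aeval TV g) →
      LT u ∈ LinearMap.ker (aeval TW g) := by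
    intro g u hu
    rw [LinearMap.mem_ker] at hu ⊢
    rw [← aeval_apply_of_comp_eq TV TW LT hLT_T g u, hu, map_zero]
  -- (5) Gram identities mod 167 and vanishing of coordinate sums on M_V, M_W
  have hLNLT : ∀ u x, LN (LT u) x = -∑ x', u x' := by
    intro u x
    rw [hLN_apply]
    simp only [hLT_apply]
    exact transpose_mulVec_mulVec_mod167 (fun y x => N x y) (fun y x => h01 x y) hrow hpair u x
  have hLTLN : ∀ w y, LT (LN w) y = -∑ y', w y' := by
    intro w y
    rw [hLT_apply]
    simp only [hLN_apply]
    exact transpose_mulVec_mulVec_mod167 N h01 hcol hcpair w y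
  have hsumV : ∀ u ∈ MV, ∑ x, u x = 0 := by
    intro u hu
    have e := sum_aeval_funLeft ρ h u
    have hu' : aeval (LinearMap.funLeft (ZMod 167) (ZMod 167) (⇑ρ)) h u = 0 := LinearMap.mem_ker.mp hu
    rw [hu'] at e
    simp only [Pi.zero_apply, Finset.sum_const_zero] at e
    exact (mul_eq_zero.mp e.symm).resolve_left h1
  have hsumW : ∀ w ∈ MW, ∑ y, w y = 0 := by
    intro w hw
    have e := sum_aeval_funLeft τ h w
    have hw' : aeval (LinearMap.funLeft (ZMod 167) (ZMod 167) (⇑τ)) h w = 0 := LinearMap.mem_ker.mp hw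
    rw [hw'] at e
    simp only [Pi.zero_apply, Finset.sum_const_zero] at e
    exact (mul_eq_zero.mp e.symm).resolve_left h1
  have hLNLT0 : ∀ u ∈ MV, LN (LT u) = 0 := by
    intro u hu
    funext x
    rw [hLNLT, hsumV u hu, neg_zero, Pi.zero_apply]
  have hLTLN0 : ∀ w ∈ MW, LT (LN w) = 0 := by
    intro w hw
    funext y
    rw [hLTLN, hsumW w hw, neg_zero, Pi.zero_apply]
  -- (6) the constant function lies in M'_W
  have one_memW' : (fun _ : B => (1 : ZMod 167)) ∈ MW' := by
    rw [LinearMap.mem_ker]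
    funext y
    have e := h1'
    rw [eval_eq_sum_range] at e
    simp only [one_pow, mul_one] at e
    rw [Pi.zero_apply, hTW, aeval_funLeft_apply]
    simp only [mul_one]
    exact e
  -- (7) orthogonality M ⊥ M' (self-reciprocity of h)
  have horthV : ∀ u ∈ MV, ∀ z ∈ MV', u ⬝ᵥ z = 0 := fun u hu z hz =>
    dotProduct_eq_zero_of_mem_ker ρ (by norm_num) hρ hcop hrec (LinearMap.mem_ker.mp hu) (LinearMap.mem_ker.mp hz)
  have horthW : ∀ w ∈ MW, ∀ z ∈ MW', w ⬝ᵥ z = 0 := fun w hw z hz =>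
    dotProduct_eq_zero_of_mem_ker τ (by norm_num) hτ hcop hrec (LinearMap.mem_ker.mp hw) (LinearMap.mem_ker.mp hz)
  -- (8) U := N̄ᵀ(M_V) ⊆ M_W and the lifting lemma: ker N̄ ∩ M_W ⊆ U
  set U : Submodule (ZMod 167) (B → ZMod 167) := MV.map LT with hU
  have hU_le : U ≤ MW := by
    rintro _ ⟨u, hu, rfl⟩
    exact hLT_mem h u hu
  have hlift : ∀ w ∈ MW, LN w = 0 → w ∈ U := by
    intro w hw hw0
    have hv : ∀ x, ∑ y, (N x y : ZMod 167) * w y = 0 := fun x => by rw [← hLN_apply, hw0, Pi.zero_apply]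
    obtain ⟨z, s, hz⟩ := lift_mod167 N h01 hcol hcpair w hv
    have hztop : z ∈ MV ⊔ MV' := by rw [hcV.sup_eq_top]; exact Submodule.mem_top
    obtain ⟨z₁, hz₁, z₂, hz₂, hz12⟩ := Submodule.mem_sup.mp hztop
    have hw_eq : w = LT z₁ + (LT z₂ + fun _ => s) := by
      funext y
      rw [Pi.add_apply, Pi.add_apply, hLT_apply, hLT_apply, hz y, ← hz12]
      simp only [Pi.add_apply, mul_add, Finset.sum_add_distrib, add_assoc]
    have hconst : (fun _ : B => s) = s • (fun _ : B => (1 : ZMod 167)) := by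
      funext y
      simp
    have hrest' : (LT z₂ + fun _ => s) ∈ MW' := by
      refine Submodule.add_mem _ (hLT_mem h' z₂ hz₂) ?_
      rw [hconst]
      exact Submodule.smul_mem _ s one_memW'
    have hrest : (LT z₂ + fun _ => s) ∈ MW := by
      have e : (LT z₂ + fun _ => s) = w - LT z₁ := by rw [hw_eq]; abel
      rw [e]
      exact Submodule.sub_mem _ hw (hLT_mem h z₁ hz₁)
    have hrest0 : (LT z₂ + fun _ => s) = 0 := by
      have e : (LT z₂ + fun _ => s) ∈ MW ⊓ MW' := Submodule.mem_inf.mpr ⟨hrest, hrest'⟩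
      rw [hcW.inf_eq_bot, Submodule.mem_bot] at e
      exact e
    rw [hw_eq, hrest0, add_zero]
    exact Submodule.mem_map_of_mem hz₁
  -- (9) the dot product as a bilinear form; U^⊥ = U ⊔ M'_W
  set Bf : LinearMap.BilinForm (ZMod 167) (B → ZMod 167) := Matrix.toBilin' (1 : Matrix B B (ZMod 167)) with hBf
  have hBf_apply : ∀ v w, Bf v w = v ⬝ᵥ w := by
    intro v w
    rw [hBf, Matrix.toBilin'_apply', Matrix.one_mulVec]
  have hBf_nd : Bf.Nondegenerate := by
    rw [hBf, LinearMap.BilinForm.nondegenerate_toBilin'_iff_det_ne_zero, Matrix.det_one]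
    exact one_ne_zero
  have hUorth : Bf.orthogonal U = U ⊔ MW' := by
    apply le_antisymm
    · intro w hw
      rw [LinearMap.BilinForm.mem_orthogonal_iff] at hw
      have hwtop : w ∈ MW ⊔ MW' := by rw [hcW.sup_eq_top]; exact Submodule.mem_top
      obtain ⟨w₁, hw₁, w₂, hw₂, rfl⟩ := Submodule.mem_sup.mp hwtop
      refine Submodule.add_mem_sup ?_ hw₂
      apply hlift w₁ hw₁
      have hz : ∀ z, LN w₁ ⬝ᵥ z = 0 := by
        intro z
        have hztop : z ∈ MV ⊔ MV' := by rw [hcV.sup_eq_top]; exact Submodule.mem_top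
        obtain ⟨z₁, hz₁, z₂, hz₂, rfl⟩ := Submodule.mem_sup.mp hztop
        rw [dotProduct_add]
        have hU1 : LT z₁ ∈ U := Submodule.mem_map_of_mem hz₁
        have h0 := hw (LT z₁) hU1
        rw [hBf_apply, dotProduct_add, horthW _ (hU_le hU1) _ hw₂, add_zero] at h0
        have e1 : LN w₁ ⬝ᵥ z₁ = 0 := by rw [dotProduct_comm, ← hadj]; exact h0
        have e2 : LN w₁ ⬝ᵥ z₂ = 0 := horthV _ (hLN_mem h w₁ hw₁) _ hz₂
        rw [e1, e2, add_zero]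
      funext x
      have e := hz (Pi.single x 1)
      rwa [dotProduct_single, mul_one] at e
    · rw [sup_le_iff]
      constructor
      · rintro _ ⟨z, hz, rfl⟩
        rw [LinearMap.BilinForm.mem_orthogonal_iff]
        rintro _ ⟨z', hz', rfl⟩
        rw [hBf_apply, hadj, hLNLT0 z hz, dotProduct_zero]
      · intro w hw
        rw [LinearMap.BilinForm.mem_orthogonal_iff]
        intro u hu
        rw [hBf_apply]
        exact horthW u (hU_le hu) w hw
  -- (10) dimensions
  have hOrth := LinearMap.BilinForm.finrank_orthogonal hBf_nd U
  rw [hUorth] at hOrth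
  have hUle : Module.finrank (ZMod 167) U ≤ Module.finrank (ZMod 167) (B → ZMod 167) := Submodule.finrank_le U
  have hdisj : U ⊓ MW' = ⊥ := by
    rw [eq_bot_iff]
    intro w hw
    rw [Submodule.mem_bot]
    have e : w ∈ MW ⊓ MW' := Submodule.mem_inf.mpr ⟨hU_le (Submodule.mem_inf.mp hw).1, (Submodule.mem_inf.mp hw).2⟩
    rw [hcW.inf_eq_bot, Submodule.mem_bot] at e
    exact e
  have hsup := Submodule.finrank_sup_add_finrank_inf_eq U MW'
  rw [hdisj, finrank_bot, add_zero] at hsup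
  have hMM' : Module.finrank (ZMod 167) MW + Module.finrank (ZMod 167) MW' = Fintype.card B :=
    finrank_ker_add_finrank_ker τ hτ hmul hcop
  have hMWdim : Module.finrank (ZMod 167) MW = (blockClasses τ 29).card * h.natDegree :=
    finrank_ker_aeval_funLeft τ hp29 hτ hmul hcop hcardB
  have hcardV : Module.finrank (ZMod 167) (B → ZMod 167) = Fintype.card B := Module.finrank_fintype_fun_eq_card _
  -- (11) deg h ∣ dim U
  have hUinv : ∀ u ∈ U, TW u ∈ U := by
    rintro _ ⟨z, hz, rfl⟩
    refine ⟨TV z, mem_ker_aeval_of_mem_ker TV h hz, ?_⟩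
    exact LinearMap.congr_fun hLT_T z
  have hdvdU : h.natDegree ∣ Module.finrank (ZMod 167) U := by
    apply natDegree_dvd_finrank_of_aeval_eq_zero (TW.restrict hUinv) hirr
    have hcomp : U.subtype ∘ₗ TW.restrict hUinv = TW ∘ₗ U.subtype := LinearMap.ext fun v => rfl
    refine LinearMap.ext fun v => Subtype.ext ?_
    have e := aeval_apply_of_comp_eq (TW.restrict hUinv) TW U.subtype hcomp h v
    rw [Submodule.subtype_apply] at e
    rw [e, LinearMap.zero_apply, Submodule.coe_zero, Submodule.subtype_apply]
    exact LinearMap.mem_ker.mp (hU_le v.2)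
  -- (12) arithmetic: #classes · deg h = dim M_W = 2 dim U = 2 · deg h · e
  obtain ⟨e, he⟩ := hdvdU
  have hkey : (blockClasses τ 29).card * h.natDegree = 2 * e * h.natDegree := by
    have : (blockClasses τ 29).card * h.natDegree = 2 * (h.natDegree * e) := by omega
    rw [this]; ring
  exact ⟨e, Nat.eq_of_mul_eq_mul_right hdpos hkey⟩

/-- **No automorphism of order 29 (kernel).**  A `0/1` incidence function on `667 + 667` points/blocks with row and column sums
`333` and row/column inner products `166` (a symmetric 2-(667,333,166) design) has no automorphism pair `(ρ, τ)` with
`ρ^29 = τ^29 = 1`, `ρ ≠ 1`: by `automorphism_29_fixedPointFree` there would be exactly `23` block classes, by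
`two_dvd_card_blockClasses_29` an even number. -/
theorem no_automorphism_29 (N : P → B → ℤ) (h01 : ∀ x y, N x y = 0 ∨ N x y = 1)
    (hrow : ∀ x, ∑ y, N x y = 333) (hpair : ∀ x x', x ≠ x' → ∑ y, N x y * N x' y = 166)
    (hcol : ∀ y, ∑ x, N x y = 333) (hcpair : ∀ y y', y ≠ y' → ∑ x, N x y * N x y' = 166)
    (hP : Fintype.card P = 667) (hB : Fintype.card B = 667)
    (ρ : Equiv.Perm P) (τ : Equiv.Perm B) (hN : ∀ x y, N (ρ x) (τ y) = N x y)
    (hρ : ρ ^ 29 = 1) (hτ : τ ^ 29 = 1) (x₀ : P) (hx₀ : ρ x₀ ≠ x₀) : False := by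
  obtain ⟨hc, hfix, -, -⟩ := automorphism_29_fixedPointFree N h01 hrow hpair hcol hcpair hP hB ρ τ hN hρ hτ x₀ hx₀
  have hp : Nat.Prime 29 := by norm_num
  have hcardB : Fintype.card B = (blockClasses τ 29).card * 29 := by
    have e := card_fixed_add_classes τ hp hτ
    rw [hfix, zero_add] at e
    exact e.symm
  have h2 := two_dvd_card_blockClasses_29 N h01 hrow hpair hcol hcpair ρ τ hN hρ hτ hcardB
  rw [hc] at h2
  omega

end Summit.Ventures.DiscreteObjects.Hadamard
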